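import Mathlib
import HarnessLib
import Summits.HubbardSuperconductivity.HubbardSuperconductivity.Theorems.KLProgrammeKLRegimeEnginePairTransferGridSmearing

/-!
# Route `KLProgramme` — ENGINE child gen 8 (stmt-HubbardSuperconductivity-20437 `KLRegimeEngineV17F2`), skeleton v2 class #5 rev 3: the STEP's kernel rows `M4 M6 M2` / `η4 η6 η2`
# IN GRID CURRENCY — **`klmg_kernel4_le_gridBinomial`**, **`klmg_kernel6_le_gridBinomial`**, **`klmg_selfEnergy_le_gridBinomial`**, **`klmg_kernelDiff4_le_gridBinomial₂`**,
# **`klmg_kernelDiff6_le_gridBinomial₂`**, **`klmg_selfEnergyDiff_le_gridBinomial₂`** (rows 38/43 re-keyed on the grid pullback; cure of «(X).3-BINOMIAL-CURRENCY»)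
# (cell gate-hubbard-kl, seat hubbard-kl-k3c1-p1 g14, technique «composed-map remainder propagation»: carrier = `map S ∘ e^{Δ_{SᵀS_ΦS}}` of the grid action)

WHY.  Rows 40/41 (`klmd_defect(Diff)_le_masses_family`, `pairTransferStep7_of_analytic_masses`) take INTENSIVE sups `M4 M6 M2` (over all labels, of the 4-point / 6-point /
self-energy pins of the member carriers `𝓜ᵢ(t) = e^{Δ_{S_{ψᵢ} + C_{>Λ_{n+1}} − C_{>Λ(t)}}}𝒲^K_{Λ(t)}`) and `η4 η6 η2` (pin differences).  Rows 38/43 supplied them from a MOMENTUM-label Gram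
constant — extensive (HOME/STATUS k3c1-p1 g14 «(X).3-BINOMIAL-CURRENCY»).  Here the same rows are keyed on GRID data (`…GridSmearing`): with `S = hubbardGridSub … (4M)`,
`Φ_t = ψ + (w_{Λ_{n+1}} − w_{Λ(t)})` the running symbol (the `Φ` pin of `klmd_pinnedDefect_eq_resolved`; `klmf_carrierCov_eq`) and `Gg(t) = effAction (SᵀC^K_{>Λ(t)}S)(V_N + 𝒩_{K,N})`
the GRID effective action at the running cutoff (`𝒲^K_{Λ(t)} = map S Gg(t)`, `klmg_effectiveActionCT_eq_map_grid`), pinned by `rfl`-able equations: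
* **`klmg_kernel4_le_gridBinomial`** / **`…6…`** / **`klmg_selfEnergy_le_gridBinomial`** — from `IsGramBoundedR (Sᵀ·softCovOf K Φ_t·S) γ` [= the MASS `(βL²)⁻¹Σ Φ_t/ρ_K`,
  `klmg_isGramBoundedR_gridSub_softCovOf_of_mass_le`; `≤ 6047` β-uniformly for any running symbol by k3c2-p1's `infraredGram_frame_le`] and the pinned GRID kernel norms `N_g` of
  `Gg(t)` [class #1 / scale-0 lane currency: the output shape of `sum_norm_kernel_effAction_le_of_gramBounded`]:
  `‖V t X‖ ≤ (4!/(βL²))·(#legs·Σ_{m′ ≥ 2} C(2m′,4)γ^{2m′−4}N_g(m′))`, `‖V6 t X‖ ≤ (6!/(βL²))·(#legs·Σ_{m′ ≥ 3} …)`, `‖Sg t p σ‖ ≤ (2!/(βL²))·(#legs·Σ_{m′ ≥ 1} …)`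
  (`#legs = 16ML²`: prefactors `4·m!·(4M)/β`, intensive with the grid vertex scale inside `N_g`);
* **`klmg_kernelDiff4_le_gridBinomial₂`** / **`…6…`** / **`klmg_selfEnergyDiff_le_gridBinomial₂`** — TWO members: from the MASS-SENSITIVE Gram constant `κD` of the `D`-line
  `Sᵀ·softCovOf K (ψ₁ − ψ₂)·S` (`∝ klIdxMass` for the family pair), member 2's `γ₂` and `N_g`:
  `‖V₁ t X − V₂ t X‖ ≤ (4!/(βL²))·(#legs·Σ_{m′ > 2} C(2m′,4)κD^{2m′−4}·N^car₂(m′))`, `N^car₂(m′) = Σ_{m″ ≥ m′} C(2m″,2m′)γ₂^{2m″−2m′}N_g(m″)` (alike for 6, Σ).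
Composition over `…GridSmearing`; nothing about the model's sizes is asserted; nothing asserts (X).3, (c), K3 or superconductivity.  0 kit · 0 lit.
-/

noncomputable section

namespace Summit.HubbardSuperconductivity.HubbardSuperconductivity.Theorems.KLRegimeSplit

set_option linter.dupNamespace false -- summit = problem name (single-conjunct summit), D-0017

open Finset Matrix Set Literature.MathematicalPhysics.QuantumLattice Literature.Probability.LatticeModels GrassmannAlgebra
open Summit.HubbardSuperconductivity.HubbardSuperconductivity.Theorems.KLProgrammeLegKernels
open Summit.HubbardSuperconductivity.HubbardSuperconductivity.Theorems.TwoPointAssembly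
open Summit.HubbardSuperconductivity.HubbardSuperconductivity.Theorems.DispersionFlow
open Summit.HubbardSuperconductivity.HubbardSuperconductivity.Theorems.KLRegimeWick
open Summit.HubbardSuperconductivity.HubbardSuperconductivity.Theorems.EngineV8

variable (L M : ℕ) [NeZero L] [NeZero M] (β U μ : ℝ) (K : TrigPolyC4v)

/-! ## §1 One member: the pins `V V6 Sg` at all labels from the running symbol's MASS Gram constant and the grid action's pinned norms -/

section Member

/-- **`klmg_kernel4_le_gridBinomial`** — the 4-point pin `V` of `klmd_pinnedDefect_eq_resolved` at ALL labels (the `M4` row of rows 40/41, this member), GRID currency: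
`‖V t X‖ ≤ (4!/(βL²))·(#legs·Σ_{m′} [2 ≤ m′]·C(2m′,4)·γ^{2m′−4}·N_g(m′))`. -/
theorem klmg_kernel4_le_gridBinomial (hβ : 0 < β) (n : ℕ) (ψ : FreqMomentum L M → ℝ)
    (V : ℝ → (Fin 4 → HubbardFieldIdx L M) → ℂ) (hV : V = fun t X => vertexFn L M β (gaussConv ℂ (softCovOf L M β μ K ψ + hubbardCovAboveCT L M β μ 0 K (klScale klE0 (n + 1)) -
            hubbardCovAboveCT L M β μ 0 K (klScale klE0 n + t * (klScale klE0 (n + 1) - klScale klE0 n))) (hubbardEffectiveActionCT L M β U μ 0 K (klScale klE0 n + t * (klScale klE0 (n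
            + 1) - klScale klE0 n)))) 4 X)
    (Φ : ℝ → FreqMomentum L M → ℝ) (hΦ : Φ = fun t k => ψ k + (hubbardCutoffWeightCT L M β μ K (klScale klE0 (n + 1)) k - hubbardCutoffWeightCT L M β μ K (klScale klE0 n + t * (klScale
            klE0 (n + 1) - klScale klE0 n)) k))
    (Gg : ℝ → GrassmannAlgebra ℂ (GridLeg (GridPoint L (2 * (2 * M)))))
    (hGg : Gg = fun t => effAction ℂ ((hubbardGridSub L M β (2 * (2 * M))).transpose * hubbardCovAboveCT L M β μ 0 K (klScale klE0 n + t * (klScale klE0 (n + 1) - klScale klE0 n)) *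
            hubbardGridSub L M β (2 * (2 * M))) (hubbardGridInteraction L (2 * (2 * M)) β U + hubbardGridCounterQuadratic L (2 * (2 * M)) β K))
    (t : ℝ) {γ : ℝ} (hγ : 0 ≤ γ) (hGB : IsGramBoundedR ((hubbardGridSub L M β (2 * (2 * M))).transpose * softCovOf L M β μ K (Φ t) * hubbardGridSub L M β (2 * (2 * M))) γ)
    (Ng : ℕ → ℝ) (hN0 : ∀ m', 0 ≤ Ng m')
    (hN : ∀ m' (j : Fin (2 * m')) (w : GridLeg (GridPoint L (2 * (2 * M)))),
      ∑ Y ∈ univ.filter (fun Y : Fin (2 * m') → GridLeg (GridPoint L (2 * (2 * M))) => Y j = w), ‖kernel ℂ (Gg t) (2 * m') Y‖ ≤ Ng m')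
    (X : Fin 4 → HubbardFieldIdx L M) :
    ‖V t X‖ ≤ ((2 * 2).factorial : ℝ) / (β * (L : ℝ) ^ 2) * (Fintype.card (GridLeg (GridPoint L (2 * (2 * M)))) *
        ∑ m' ∈ range (Fintype.card (GridLeg (GridPoint L (2 * (2 * M)))) / 2 + 1), if 2 ≤ m' then ((2 * m').choose (2 * 2) : ℝ) * γ ^ (2 * m' - 2 * 2) * Ng m' else 0) := by
  have hG : effAction ℂ ((hubbardGridSub L M β (2 * (2 * M))).transpose * hubbardCovAboveCT L M β μ 0 K (klScale klE0 n + t * (klScale klE0 (n + 1) - klScale klE0 n)) *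
      hubbardGridSub L M β (2 * (2 * M))) (hubbardGridInteraction L (2 * (2 * M)) β U + hubbardGridCounterQuadratic L (2 * (2 * M)) β K) = Gg t := by rw [hGg]
  subst hV
  dsimp only
  rw [klmd_carrierCov_eq_softCovOf_pin L M β μ K n ψ Φ hΦ t, klmg_carrier_eq_map_grid L M β U μ K hβ.ne', hG]
  exact klmg_vertexFn_map_gaussConv_le_binomial L M β hβ _ hγ hGB _ (hG ▸ klmg_gridAction_mem_evenPart L β U K _) Ng hN0 hN (p := 2) (by norm_num) X

/-- **`klmg_kernel6_le_gridBinomial`** — the same for the 6-point pin `V6` (the `M6` row): `‖V6 t X‖ ≤ (6!/(βL²))·(#legs·Σ_{m′} [3 ≤ m′]·C(2m′,6)·γ^{2m′−6}·N_g(m′))`. -/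
theorem klmg_kernel6_le_gridBinomial (hβ : 0 < β) (n : ℕ) (ψ : FreqMomentum L M → ℝ)
    (V6 : ℝ → (Fin 6 → HubbardFieldIdx L M) → ℂ) (hV6 : V6 = fun t X => vertexFn L M β (gaussConv ℂ (softCovOf L M β μ K ψ + hubbardCovAboveCT L M β μ 0 K (klScale klE0 (n + 1)) -
            hubbardCovAboveCT L M β μ 0 K (klScale klE0 n + t * (klScale klE0 (n + 1) - klScale klE0 n))) (hubbardEffectiveActionCT L M β U μ 0 K (klScale klE0 n + t * (klScale klE0 (n
            + 1) - klScale klE0 n)))) 6 X)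
    (Φ : ℝ → FreqMomentum L M → ℝ) (hΦ : Φ = fun t k => ψ k + (hubbardCutoffWeightCT L M β μ K (klScale klE0 (n + 1)) k - hubbardCutoffWeightCT L M β μ K (klScale klE0 n + t * (klScale
            klE0 (n + 1) - klScale klE0 n)) k))
    (Gg : ℝ → GrassmannAlgebra ℂ (GridLeg (GridPoint L (2 * (2 * M)))))
    (hGg : Gg = fun t => effAction ℂ ((hubbardGridSub L M β (2 * (2 * M))).transpose * hubbardCovAboveCT L M β μ 0 K (klScale klE0 n + t * (klScale klE0 (n + 1) - klScale klE0 n)) *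
            hubbardGridSub L M β (2 * (2 * M))) (hubbardGridInteraction L (2 * (2 * M)) β U + hubbardGridCounterQuadratic L (2 * (2 * M)) β K))
    (t : ℝ) {γ : ℝ} (hγ : 0 ≤ γ) (hGB : IsGramBoundedR ((hubbardGridSub L M β (2 * (2 * M))).transpose * softCovOf L M β μ K (Φ t) * hubbardGridSub L M β (2 * (2 * M))) γ)
    (Ng : ℕ → ℝ) (hN0 : ∀ m', 0 ≤ Ng m')
    (hN : ∀ m' (j : Fin (2 * m')) (w : GridLeg (GridPoint L (2 * (2 * M)))),
      ∑ Y ∈ univ.filter (fun Y : Fin (2 * m') → GridLeg (GridPoint L (2 * (2 * M))) => Y j = w), ‖kernel ℂ (Gg t) (2 * m') Y‖ ≤ Ng m')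
    (X : Fin 6 → HubbardFieldIdx L M) :
    ‖V6 t X‖ ≤ ((2 * 3).factorial : ℝ) / (β * (L : ℝ) ^ 2) * (Fintype.card (GridLeg (GridPoint L (2 * (2 * M)))) *
        ∑ m' ∈ range (Fintype.card (GridLeg (GridPoint L (2 * (2 * M)))) / 2 + 1), if 3 ≤ m' then ((2 * m').choose (2 * 3) : ℝ) * γ ^ (2 * m' - 2 * 3) * Ng m' else 0) := by
  have hG : effAction ℂ ((hubbardGridSub L M β (2 * (2 * M))).transpose * hubbardCovAboveCT L M β μ 0 K (klScale klE0 n + t * (klScale klE0 (n + 1) - klScale klE0 n)) *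
      hubbardGridSub L M β (2 * (2 * M))) (hubbardGridInteraction L (2 * (2 * M)) β U + hubbardGridCounterQuadratic L (2 * (2 * M)) β K) = Gg t := by rw [hGg]
  subst hV6
  dsimp only
  rw [klmd_carrierCov_eq_softCovOf_pin L M β μ K n ψ Φ hΦ t, klmg_carrier_eq_map_grid L M β U μ K hβ.ne', hG]
  exact klmg_vertexFn_map_gaussConv_le_binomial L M β hβ _ hγ hGB _ (hG ▸ klmg_gridAction_mem_evenPart L β U K _) Ng hN0 hN (p := 3) (by norm_num) X

/-- **`klmg_selfEnergy_le_gridBinomial`** — the same for the self-energy pin `Sg` (the `M2` row): `‖Sg t p σ‖ ≤ (2!/(βL²))·(#legs·Σ_{m′} [1 ≤ m′]·C(2m′,2)·γ^{2m′−2}·N_g(m′))`. -/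
theorem klmg_selfEnergy_le_gridBinomial (hβ : 0 < β) (n : ℕ) (ψ : FreqMomentum L M → ℝ)
    (Sg : ℝ → FreqMomentum L M → Fin 2 → ℂ) (hSg : Sg = fun t p σ => selfEnergy L M β (gaussConv ℂ (softCovOf L M β μ K ψ + hubbardCovAboveCT L M β μ 0 K (klScale klE0 (n + 1)) -
            hubbardCovAboveCT L M β μ 0 K (klScale klE0 n + t * (klScale klE0 (n + 1) - klScale klE0 n))) (hubbardEffectiveActionCT L M β U μ 0 K (klScale klE0 n + t * (klScale klE0 (n
            + 1) - klScale klE0 n)))) p σ)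
    (Φ : ℝ → FreqMomentum L M → ℝ) (hΦ : Φ = fun t k => ψ k + (hubbardCutoffWeightCT L M β μ K (klScale klE0 (n + 1)) k - hubbardCutoffWeightCT L M β μ K (klScale klE0 n + t * (klScale
            klE0 (n + 1) - klScale klE0 n)) k))
    (Gg : ℝ → GrassmannAlgebra ℂ (GridLeg (GridPoint L (2 * (2 * M)))))
    (hGg : Gg = fun t => effAction ℂ ((hubbardGridSub L M β (2 * (2 * M))).transpose * hubbardCovAboveCT L M β μ 0 K (klScale klE0 n + t * (klScale klE0 (n + 1) - klScale klE0 n)) *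
            hubbardGridSub L M β (2 * (2 * M))) (hubbardGridInteraction L (2 * (2 * M)) β U + hubbardGridCounterQuadratic L (2 * (2 * M)) β K))
    (t : ℝ) {γ : ℝ} (hγ : 0 ≤ γ) (hGB : IsGramBoundedR ((hubbardGridSub L M β (2 * (2 * M))).transpose * softCovOf L M β μ K (Φ t) * hubbardGridSub L M β (2 * (2 * M))) γ)
    (Ng : ℕ → ℝ) (hN0 : ∀ m', 0 ≤ Ng m')
    (hN : ∀ m' (j : Fin (2 * m')) (w : GridLeg (GridPoint L (2 * (2 * M)))),
      ∑ Y ∈ univ.filter (fun Y : Fin (2 * m') → GridLeg (GridPoint L (2 * (2 * M))) => Y j = w), ‖kernel ℂ (Gg t) (2 * m') Y‖ ≤ Ng m')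
    (p : FreqMomentum L M) (σ : Fin 2) :
    ‖Sg t p σ‖ ≤ ((2 * 1).factorial : ℝ) / (β * (L : ℝ) ^ 2) * (Fintype.card (GridLeg (GridPoint L (2 * (2 * M)))) *
        ∑ m' ∈ range (Fintype.card (GridLeg (GridPoint L (2 * (2 * M)))) / 2 + 1), if 1 ≤ m' then ((2 * m').choose (2 * 1) : ℝ) * γ ^ (2 * m' - 2 * 1) * Ng m' else 0) := by
  have hG : effAction ℂ ((hubbardGridSub L M β (2 * (2 * M))).transpose * hubbardCovAboveCT L M β μ 0 K (klScale klE0 n + t * (klScale klE0 (n + 1) - klScale klE0 n)) *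
      hubbardGridSub L M β (2 * (2 * M))) (hubbardGridInteraction L (2 * (2 * M)) β U + hubbardGridCounterQuadratic L (2 * (2 * M)) β K) = Gg t := by rw [hGg]
  subst hSg
  dsimp only
  rw [selfEnergy, klmd_carrierCov_eq_softCovOf_pin L M β μ K n ψ Φ hΦ t, klmg_carrier_eq_map_grid L M β U μ K hβ.ne', hG]
  exact klmg_vertexFn_map_gaussConv_le_binomial L M β hβ _ hγ hGB _ (hG ▸ klmg_gridAction_mem_evenPart L β U K _) Ng hN0 hN (p := 1) (by norm_num) _

end Member

/-! ## §2 Two members: the pin differences from the `D`-line's MASS-sensitive Gram constant (two levels) -/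

section Pair

omit [NeZero M] in
/-- The two carriers' covariances: `S_{ψ₁} + C_{>Λ_{n+1}} − C_{>Λ(t)} = S_{ψ₁ − ψ₂} + S_{Φ₂(t)}` (`klmf_softCovOf_eq_sub_add` + the `Φ` pin of member 2). -/
theorem klmg_carrierCov_eq_sub_add_pin (n : ℕ) (ψ₁ ψ₂ : FreqMomentum L M → ℝ)
    (Φ₂ : ℝ → FreqMomentum L M → ℝ) (hΦ₂ : Φ₂ = fun t k => ψ₂ k + (hubbardCutoffWeightCT L M β μ K (klScale klE0 (n + 1)) k - hubbardCutoffWeightCT L M β μ K (klScale klE0 n + t *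
            (klScale klE0 (n + 1) - klScale klE0 n)) k)) (t : ℝ) :
    softCovOf L M β μ K ψ₁ + hubbardCovAboveCT L M β μ 0 K (klScale klE0 (n + 1)) - hubbardCovAboveCT L M β μ 0 K (klScale klE0 n + t * (klScale klE0 (n + 1) - klScale klE0 n)) =
      softCovOf L M β μ K (ψ₁ - ψ₂) + softCovOf L M β μ K (Φ₂ t) := by
  rw [← klmd_carrierCov_eq_softCovOf_pin L M β μ K n ψ₂ Φ₂ hΦ₂ t, klmf_softCovOf_eq_sub_add L M β μ K ψ₁ ψ₂]
  abel

/-- **`klmg_kernelDiff4_le_gridBinomial₂`** — the 4-point pin difference of the two members (the `η4` row), GRID currency, two levels: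
`‖V₁ t X − V₂ t X‖ ≤ (4!/(βL²))·(#legs·Σ_{m′} [2 < m′]·C(2m′,4)·κD^{2m′−4}·N^car₂(m′))`, `N^car₂(m′) = Σ_{m″} [m′ ≤ m″]·C(2m″,2m′)·γ₂^{2m″−2m′}·N_g(m″)`. -/
theorem klmg_kernelDiff4_le_gridBinomial₂ (hβ : 0 < β) (n : ℕ) (ψ₁ ψ₂ : FreqMomentum L M → ℝ)
    (V₁ : ℝ → (Fin 4 → HubbardFieldIdx L M) → ℂ) (hV₁ : V₁ = fun t X => vertexFn L M β (gaussConv ℂ (softCovOf L M β μ K ψ₁ + hubbardCovAboveCT L M β μ 0 K (klScale klE0 (n + 1)) -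
            hubbardCovAboveCT L M β μ 0 K (klScale klE0 n + t * (klScale klE0 (n + 1) - klScale klE0 n))) (hubbardEffectiveActionCT L M β U μ 0 K (klScale klE0 n + t * (klScale klE0 (n
            + 1) - klScale klE0 n)))) 4 X)
    (V₂ : ℝ → (Fin 4 → HubbardFieldIdx L M) → ℂ) (hV₂ : V₂ = fun t X => vertexFn L M β (gaussConv ℂ (softCovOf L M β μ K ψ₂ + hubbardCovAboveCT L M β μ 0 K (klScale klE0 (n + 1)) -
            hubbardCovAboveCT L M β μ 0 K (klScale klE0 n + t * (klScale klE0 (n + 1) - klScale klE0 n))) (hubbardEffectiveActionCT L M β U μ 0 K (klScale klE0 n + t * (klScale klE0 (n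
            + 1) - klScale klE0 n)))) 4 X)
    (Φ₂ : ℝ → FreqMomentum L M → ℝ) (hΦ₂ : Φ₂ = fun t k => ψ₂ k + (hubbardCutoffWeightCT L M β μ K (klScale klE0 (n + 1)) k - hubbardCutoffWeightCT L M β μ K (klScale klE0 n + t *
            (klScale klE0 (n + 1) - klScale klE0 n)) k))
    (Gg : ℝ → GrassmannAlgebra ℂ (GridLeg (GridPoint L (2 * (2 * M)))))
    (hGg : Gg = fun t => effAction ℂ ((hubbardGridSub L M β (2 * (2 * M))).transpose * hubbardCovAboveCT L M β μ 0 K (klScale klE0 n + t * (klScale klE0 (n + 1) - klScale klE0 n)) *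
            hubbardGridSub L M β (2 * (2 * M))) (hubbardGridInteraction L (2 * (2 * M)) β U + hubbardGridCounterQuadratic L (2 * (2 * M)) β K))
    {κD : ℝ} (hκD : 0 ≤ κD) (hGBD : IsGramBoundedR ((hubbardGridSub L M β (2 * (2 * M))).transpose * softCovOf L M β μ K (ψ₁ - ψ₂) * hubbardGridSub L M β (2 * (2 * M))) κD)
    (t : ℝ) {γ₂ : ℝ} (hγ₂ : 0 ≤ γ₂) (hGB₂ : IsGramBoundedR ((hubbardGridSub L M β (2 * (2 * M))).transpose * softCovOf L M β μ K (Φ₂ t) * hubbardGridSub L M β (2 * (2 * M))) γ₂)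
    (Ng : ℕ → ℝ) (hN0 : ∀ m', 0 ≤ Ng m')
    (hN : ∀ m' (j : Fin (2 * m')) (w : GridLeg (GridPoint L (2 * (2 * M)))),
      ∑ Y ∈ univ.filter (fun Y : Fin (2 * m') → GridLeg (GridPoint L (2 * (2 * M))) => Y j = w), ‖kernel ℂ (Gg t) (2 * m') Y‖ ≤ Ng m')
    (X : Fin 4 → HubbardFieldIdx L M) :
    ‖V₁ t X - V₂ t X‖ ≤ ((2 * 2).factorial : ℝ) / (β * (L : ℝ) ^ 2) * (Fintype.card (GridLeg (GridPoint L (2 * (2 * M)))) *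
        ∑ m' ∈ range (Fintype.card (GridLeg (GridPoint L (2 * (2 * M)))) / 2 + 1), if 2 < m' then ((2 * m').choose (2 * 2) : ℝ) * κD ^ (2 * m' - 2 * 2) *
          (∑ m'' ∈ range (Fintype.card (GridLeg (GridPoint L (2 * (2 * M)))) / 2 + 1), if m' ≤ m'' then ((2 * m'').choose (2 * m') : ℝ) * γ₂ ^ (2 * m'' - 2 * m') * Ng m'' else 0)
          else 0) := by
  have hG : effAction ℂ ((hubbardGridSub L M β (2 * (2 * M))).transpose * hubbardCovAboveCT L M β μ 0 K (klScale klE0 n + t * (klScale klE0 (n + 1) - klScale klE0 n)) *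
      hubbardGridSub L M β (2 * (2 * M))) (hubbardGridInteraction L (2 * (2 * M)) β U + hubbardGridCounterQuadratic L (2 * (2 * M)) β K) = Gg t := by rw [hGg]
  subst hV₁ hV₂
  dsimp only
  rw [klmg_carrierCov_eq_sub_add_pin L M β μ K n ψ₁ ψ₂ Φ₂ hΦ₂ t, klmd_carrierCov_eq_softCovOf_pin L M β μ K n ψ₂ Φ₂ hΦ₂ t,
    klmg_carrier_eq_map_grid L M β U μ K hβ.ne' (softCovOf L M β μ K (ψ₁ - ψ₂) + softCovOf L M β μ K (Φ₂ t)),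
    klmg_carrier_eq_map_grid L M β U μ K hβ.ne' (softCovOf L M β μ K (Φ₂ t)), Matrix.mul_add, Matrix.add_mul, hG]
  exact klmg_vertexFn_map_gaussConv_sub_le_binomial₂ L M β hβ _ hκD hGBD hγ₂ hGB₂ _ (hG ▸ klmg_gridAction_mem_evenPart L β U K _) Ng hN0 hN (p := 2) (by norm_num) X

/-- **`klmg_kernelDiff6_le_gridBinomial₂`** — the same for the 6-point pins (the `η6` row): `‖V6₁ t X − V6₂ t X‖ ≤ (6!/(βL²))·(#legs·Σ_{m′} [3 < m′]·C(2m′,6)·κD^{2m′−6}·N^car₂(m′))`. -/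
theorem klmg_kernelDiff6_le_gridBinomial₂ (hβ : 0 < β) (n : ℕ) (ψ₁ ψ₂ : FreqMomentum L M → ℝ)
    (V6₁ : ℝ → (Fin 6 → HubbardFieldIdx L M) → ℂ) (hV6₁ : V6₁ = fun t X => vertexFn L M β (gaussConv ℂ (softCovOf L M β μ K ψ₁ + hubbardCovAboveCT L M β μ 0 K (klScale klE0 (n + 1)) -
            hubbardCovAboveCT L M β μ 0 K (klScale klE0 n + t * (klScale klE0 (n + 1) - klScale klE0 n))) (hubbardEffectiveActionCT L M β U μ 0 K (klScale klE0 n + t * (klScale klE0 (n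
            + 1) - klScale klE0 n)))) 6 X)
    (V6₂ : ℝ → (Fin 6 → HubbardFieldIdx L M) → ℂ) (hV6₂ : V6₂ = fun t X => vertexFn L M β (gaussConv ℂ (softCovOf L M β μ K ψ₂ + hubbardCovAboveCT L M β μ 0 K (klScale klE0 (n + 1)) -
            hubbardCovAboveCT L M β μ 0 K (klScale klE0 n + t * (klScale klE0 (n + 1) - klScale klE0 n))) (hubbardEffectiveActionCT L M β U μ 0 K (klScale klE0 n + t * (klScale klE0 (n
            + 1) - klScale klE0 n)))) 6 X)
    (Φ₂ : ℝ → FreqMomentum L M → ℝ) (hΦ₂ : Φ₂ = fun t k => ψ₂ k + (hubbardCutoffWeightCT L M β μ K (klScale klE0 (n + 1)) k - hubbardCutoffWeightCT L M β μ K (klScale klE0 n + t *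
            (klScale klE0 (n + 1) - klScale klE0 n)) k))
    (Gg : ℝ → GrassmannAlgebra ℂ (GridLeg (GridPoint L (2 * (2 * M)))))
    (hGg : Gg = fun t => effAction ℂ ((hubbardGridSub L M β (2 * (2 * M))).transpose * hubbardCovAboveCT L M β μ 0 K (klScale klE0 n + t * (klScale klE0 (n + 1) - klScale klE0 n)) *
            hubbardGridSub L M β (2 * (2 * M))) (hubbardGridInteraction L (2 * (2 * M)) β U + hubbardGridCounterQuadratic L (2 * (2 * M)) β K))
    {κD : ℝ} (hκD : 0 ≤ κD) (hGBD : IsGramBoundedR ((hubbardGridSub L M β (2 * (2 * M))).transpose * softCovOf L M β μ K (ψ₁ - ψ₂) * hubbardGridSub L M β (2 * (2 * M))) κD)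
    (t : ℝ) {γ₂ : ℝ} (hγ₂ : 0 ≤ γ₂) (hGB₂ : IsGramBoundedR ((hubbardGridSub L M β (2 * (2 * M))).transpose * softCovOf L M β μ K (Φ₂ t) * hubbardGridSub L M β (2 * (2 * M))) γ₂)
    (Ng : ℕ → ℝ) (hN0 : ∀ m', 0 ≤ Ng m')
    (hN : ∀ m' (j : Fin (2 * m')) (w : GridLeg (GridPoint L (2 * (2 * M)))),
      ∑ Y ∈ univ.filter (fun Y : Fin (2 * m') → GridLeg (GridPoint L (2 * (2 * M))) => Y j = w), ‖kernel ℂ (Gg t) (2 * m') Y‖ ≤ Ng m')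
    (X : Fin 6 → HubbardFieldIdx L M) :
    ‖V6₁ t X - V6₂ t X‖ ≤ ((2 * 3).factorial : ℝ) / (β * (L : ℝ) ^ 2) * (Fintype.card (GridLeg (GridPoint L (2 * (2 * M)))) *
        ∑ m' ∈ range (Fintype.card (GridLeg (GridPoint L (2 * (2 * M)))) / 2 + 1), if 3 < m' then ((2 * m').choose (2 * 3) : ℝ) * κD ^ (2 * m' - 2 * 3) *
          (∑ m'' ∈ range (Fintype.card (GridLeg (GridPoint L (2 * (2 * M)))) / 2 + 1), if m' ≤ m'' then ((2 * m'').choose (2 * m') : ℝ) * γ₂ ^ (2 * m'' - 2 * m') * Ng m'' else 0)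
          else 0) := by
  have hG : effAction ℂ ((hubbardGridSub L M β (2 * (2 * M))).transpose * hubbardCovAboveCT L M β μ 0 K (klScale klE0 n + t * (klScale klE0 (n + 1) - klScale klE0 n)) *
      hubbardGridSub L M β (2 * (2 * M))) (hubbardGridInteraction L (2 * (2 * M)) β U + hubbardGridCounterQuadratic L (2 * (2 * M)) β K) = Gg t := by rw [hGg]
  subst hV6₁ hV6₂
  dsimp only
  rw [klmg_carrierCov_eq_sub_add_pin L M β μ K n ψ₁ ψ₂ Φ₂ hΦ₂ t, klmd_carrierCov_eq_softCovOf_pin L M β μ K n ψ₂ Φ₂ hΦ₂ t,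
    klmg_carrier_eq_map_grid L M β U μ K hβ.ne' (softCovOf L M β μ K (ψ₁ - ψ₂) + softCovOf L M β μ K (Φ₂ t)),
    klmg_carrier_eq_map_grid L M β U μ K hβ.ne' (softCovOf L M β μ K (Φ₂ t)), Matrix.mul_add, Matrix.add_mul, hG]
  exact klmg_vertexFn_map_gaussConv_sub_le_binomial₂ L M β hβ _ hκD hGBD hγ₂ hGB₂ _ (hG ▸ klmg_gridAction_mem_evenPart L β U K _) Ng hN0 hN (p := 3) (by norm_num) X

/-- **`klmg_selfEnergyDiff_le_gridBinomial₂`** — the same for the self-energy pins (the `η2` row): `‖Sg₁ t p σ − Sg₂ t p σ‖ ≤ (2!/(βL²))·(#legs·Σ_{m′} [1 < m′]·C(2m′,2)·κD^{2m′−2}·N^car₂(m′))`. -/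
theorem klmg_selfEnergyDiff_le_gridBinomial₂ (hβ : 0 < β) (n : ℕ) (ψ₁ ψ₂ : FreqMomentum L M → ℝ)
    (Sg₁ : ℝ → FreqMomentum L M → Fin 2 → ℂ) (hSg₁ : Sg₁ = fun t p σ => selfEnergy L M β (gaussConv ℂ (softCovOf L M β μ K ψ₁ + hubbardCovAboveCT L M β μ 0 K (klScale klE0 (n + 1)) -
            hubbardCovAboveCT L M β μ 0 K (klScale klE0 n + t * (klScale klE0 (n + 1) - klScale klE0 n))) (hubbardEffectiveActionCT L M β U μ 0 K (klScale klE0 n + t * (klScale klE0 (n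
            + 1) - klScale klE0 n)))) p σ)
    (Sg₂ : ℝ → FreqMomentum L M → Fin 2 → ℂ) (hSg₂ : Sg₂ = fun t p σ => selfEnergy L M β (gaussConv ℂ (softCovOf L M β μ K ψ₂ + hubbardCovAboveCT L M β μ 0 K (klScale klE0 (n + 1)) -
            hubbardCovAboveCT L M β μ 0 K (klScale klE0 n + t * (klScale klE0 (n + 1) - klScale klE0 n))) (hubbardEffectiveActionCT L M β U μ 0 K (klScale klE0 n + t * (klScale klE0 (n
            + 1) - klScale klE0 n)))) p σ)
    (Φ₂ : ℝ → FreqMomentum L M → ℝ) (hΦ₂ : Φ₂ = fun t k => ψ₂ k + (hubbardCutoffWeightCT L M β μ K (klScale klE0 (n + 1)) k - hubbardCutoffWeightCT L M β μ K (klScale klE0 n + t *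
            (klScale klE0 (n + 1) - klScale klE0 n)) k))
    (Gg : ℝ → GrassmannAlgebra ℂ (GridLeg (GridPoint L (2 * (2 * M)))))
    (hGg : Gg = fun t => effAction ℂ ((hubbardGridSub L M β (2 * (2 * M))).transpose * hubbardCovAboveCT L M β μ 0 K (klScale klE0 n + t * (klScale klE0 (n + 1) - klScale klE0 n)) *
            hubbardGridSub L M β (2 * (2 * M))) (hubbardGridInteraction L (2 * (2 * M)) β U + hubbardGridCounterQuadratic L (2 * (2 * M)) β K))
    {κD : ℝ} (hκD : 0 ≤ κD) (hGBD : IsGramBoundedR ((hubbardGridSub L M β (2 * (2 * M))).transpose * softCovOf L M β μ K (ψ₁ - ψ₂) * hubbardGridSub L M β (2 * (2 * M))) κD)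
    (t : ℝ) {γ₂ : ℝ} (hγ₂ : 0 ≤ γ₂) (hGB₂ : IsGramBoundedR ((hubbardGridSub L M β (2 * (2 * M))).transpose * softCovOf L M β μ K (Φ₂ t) * hubbardGridSub L M β (2 * (2 * M))) γ₂)
    (Ng : ℕ → ℝ) (hN0 : ∀ m', 0 ≤ Ng m')
    (hN : ∀ m' (j : Fin (2 * m')) (w : GridLeg (GridPoint L (2 * (2 * M)))),
      ∑ Y ∈ univ.filter (fun Y : Fin (2 * m') → GridLeg (GridPoint L (2 * (2 * M))) => Y j = w), ‖kernel ℂ (Gg t) (2 * m') Y‖ ≤ Ng m')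
    (p : FreqMomentum L M) (σ : Fin 2) :
    ‖Sg₁ t p σ - Sg₂ t p σ‖ ≤ ((2 * 1).factorial : ℝ) / (β * (L : ℝ) ^ 2) * (Fintype.card (GridLeg (GridPoint L (2 * (2 * M)))) *
        ∑ m' ∈ range (Fintype.card (GridLeg (GridPoint L (2 * (2 * M)))) / 2 + 1), if 1 < m' then ((2 * m').choose (2 * 1) : ℝ) * κD ^ (2 * m' - 2 * 1) *
          (∑ m'' ∈ range (Fintype.card (GridLeg (GridPoint L (2 * (2 * M)))) / 2 + 1), if m' ≤ m'' then ((2 * m'').choose (2 * m') : ℝ) * γ₂ ^ (2 * m'' - 2 * m') * Ng m'' else 0)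
          else 0) := by
  have hG : effAction ℂ ((hubbardGridSub L M β (2 * (2 * M))).transpose * hubbardCovAboveCT L M β μ 0 K (klScale klE0 n + t * (klScale klE0 (n + 1) - klScale klE0 n)) *
      hubbardGridSub L M β (2 * (2 * M))) (hubbardGridInteraction L (2 * (2 * M)) β U + hubbardGridCounterQuadratic L (2 * (2 * M)) β K) = Gg t := by rw [hGg]
  subst hSg₁ hSg₂
  dsimp only
  rw [selfEnergy, selfEnergy, klmg_carrierCov_eq_sub_add_pin L M β μ K n ψ₁ ψ₂ Φ₂ hΦ₂ t, klmd_carrierCov_eq_softCovOf_pin L M β μ K n ψ₂ Φ₂ hΦ₂ t,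
    klmg_carrier_eq_map_grid L M β U μ K hβ.ne' (softCovOf L M β μ K (ψ₁ - ψ₂) + softCovOf L M β μ K (Φ₂ t)),
    klmg_carrier_eq_map_grid L M β U μ K hβ.ne' (softCovOf L M β μ K (Φ₂ t)), Matrix.mul_add, Matrix.add_mul, hG]
  exact klmg_vertexFn_map_gaussConv_sub_le_binomial₂ L M β hβ _ hκD hGBD hγ₂ hGB₂ _ (hG ▸ klmg_gridAction_mem_evenPart L β U K _) Ng hN0 hN (p := 1) (by norm_num) _

end Pair

end Summit.HubbardSuperconductivity.HubbardSuperconductivity.Theorems.KLRegimeSplit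

end
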